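import Literature.AlgebraicGeometry.Motives.CyclesPushforwardNormProofs
import Literature.AlgebraicGeometry.Dimension.PointDimension
import Literature.RingTheory.KrullDimension.AffineDimension
import HarnessLib

/-!
# `dim X = trdeg_K R(X)` and birational invariance of dimension

Dimension theory of integral schemes locally of finite type over a field `K` through the function
field, as needed for Fulton, *Intersection Theory*, Prop. 1.4 (a) (push-forward of principal
divisors in relative dimension one: the auxiliary schemes `X'` — the closure of the graph of a
rational function — and `ℙ¹_Y` have the dimension of `X`, resp. `dim Y + 1`).  With `⊤` the generic
point in Mathlib's specialisation order (`Order.height ⊤ = dim X`) and the `K`-algebra structure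
`K = Γ(Spec K) → Γ(X, X) → R(X)` on the function field:

* `Literature.AlgebraicGeometry.Motives.height_top_eq_ringKrullDim` — `dim X = dim A` for every
  non-empty affine chart `Spec A` (chart formula for the dimension of a point,
  `Literature.AlgebraicGeometry.Dimension.Scheme.height_eq_ringKrullDim_quotient_primeIdealOf`,
  at the generic point);
* `Literature.AlgebraicGeometry.Motives.height_top_eq_trdeg` — **`dim X = trdeg_K R(X)`**
  (Görtz–Wedhorn I, Thm. 5.22 (3); Matsumura Thm. 5.6 via
  `Literature.RingTheory.KrullDimension.ringKrullDim_eq_trdeg`), and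
  `Literature.AlgebraicGeometry.Motives.trdeg_functionField_lt_aleph0` (finiteness);
* `Literature.AlgebraicGeometry.Motives.functionFieldMap_algebraMap_top` — `p^♯ : R(Y) → R(X)` is
  `K`-linear for a dominant `K`-morphism `p`;
* `Literature.AlgebraicGeometry.Motives.height_top_eq_of_algEquiv` — **birational invariance**:
  `K`-isomorphic function fields give equal dimensions;
* `Literature.AlgebraicGeometry.Motives.height_top_eq_height_top_add_trdeg` —
  `dim X = dim Y + trdeg_{R(Y)} R(X)` for `p : X → Y` dominant (Stacks 030H, additivity).

Everything here is proved.

## References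

* [GortzWedhorn2020] U. Görtz, T. Wedhorn, *Algebraic Geometry I: Schemes*, 2nd ed. (2020),
  doi:10.1007/978-3-658-30733-2, Thm. 5.22 (dimension and transcendence degree).
* [Fulton1998] W. Fulton, *Intersection Theory*, 2nd ed. (1998), Prop. 1.4 (a), proof.
* [StacksProject] The Stacks Project, Tag 030H (additivity of transcendence degree).
-/

open CategoryTheory AlgebraicGeometry Order Topology TopologicalSpace

universe u

noncomputable section

namespace Literature.AlgebraicGeometry.Motives

section Dim

variable {K : Type u} [Field K] {Y : Scheme.{u}} [IsIntegral Y] (f : Y ⟶ Spec (.of K))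
  [LocallyOfFiniteType f]

/-- The generic point lies in every non-empty open. [folklore] -/
theorem top_mem_of_nonempty (U : Y.Opens) [h : Nonempty U] : (⊤ : Y) ∈ U :=
  ((genericPoint_spec Y).mem_open_set_iff U.isOpen).mpr (by simpa using h)

/-- On an integral scheme the prime of the generic point in an affine chart is `0`. [folklore] -/
theorem primeIdealOf_top {U : Y.Opens} (hU : IsAffineOpen U) [Nonempty U] :
    (hU.primeIdealOf ⟨⊤, top_mem_of_nonempty U⟩).asIdeal = ⊥ := by
  have h : hU.primeIdealOf ⟨⊤, top_mem_of_nonempty U⟩ = genericPoint (Spec Γ(Y, U)) :=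
    hU.primeIdealOf_genericPoint
  rw [h, genericPoint_eq_bot_of_affine]; rfl

include f in
/-- **`dim Y = dim A` for any affine chart `Spec A` of an integral scheme locally of finite type
over a field** (`Order.height` of the generic point `= dim Γ(Y, U)`): the chart formula
`height y = dim Γ(Y, U) ⧸ 𝔭_U(y)`
(`Literature.AlgebraicGeometry.Dimension.Scheme.height_eq_ringKrullDim_quotient_primeIdealOf`,
Görtz–Wedhorn I, Thm. 5.22) at the generic point, whose prime is `0`.
[cite: GortzWedhorn2020, Thm. 5.22] -/
theorem height_top_eq_ringKrullDim {U : Y.Opens} (hU : IsAffineOpen U) [Nonempty U] :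
    ((height (⊤ : Y) : ℕ∞) : WithBot ℕ∞) = ringKrullDim Γ(Y, U) := by
  rw [Dimension.Scheme.height_eq_ringKrullDim_quotient_primeIdealOf f hU (top_mem_of_nonempty U)]
  exact RingEquiv.ringKrullDim ((Ideal.quotEquivOfEq (primeIdealOf_top hU)).trans
    (RingEquiv.quotientBot _))

include f in
/-- **`dim Y = trdeg_K R(Y)`** for an integral scheme `Y` locally of finite type over a field `K`
(Görtz–Wedhorn I, Thm. 5.22 (3): `dim X = trdeg_K K(X)`), `R(Y)` being a `K`-algebra through
`K = Γ(Spec K) → Γ(Y, Y) → R(Y)`: on an affine chart `Spec A`, `dim Y = dim A`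
(`height_top_eq_ringKrullDim`) `= trdeg_K A` (Matsumura Thm. 5.6,
`Literature.RingTheory.KrullDimension.ringKrullDim_eq_trdeg`) `= trdeg_K Frac A`.
[cite: GortzWedhorn2020, Thm. 5.22 (3)] -/
theorem height_top_eq_trdeg :
    letI := ((Y.presheaf.germ ⊤ (genericPoint Y) trivial).hom.comp
      (f.appTop.hom.comp (Scheme.ΓSpecIso (.of K)).inv.hom)).toAlgebra
    ((height (⊤ : Y) : ℕ∞) : WithBot ℕ∞) =
      (Cardinal.toNat (Algebra.trdeg K Y.functionField) : WithBot ℕ∞) := by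
  letI algK := ((Y.presheaf.germ ⊤ (genericPoint Y) trivial).hom.comp
      (f.appTop.hom.comp (Scheme.ΓSpecIso (.of K)).inv.hom)).toAlgebra
  -- an affine chart `Spec A`, a finitely generated `K`-domain with fraction field `R(Y)`
  obtain ⟨_, ⟨U, hU, rfl⟩, hηU, -⟩ :=
    Y.isBasis_affineOpens.exists_subset_of_mem_open (Set.mem_univ (⊤ : Y)) isOpen_univ
  have hU : IsAffineOpen U := hU
  haveI : Nonempty U := ⟨⟨⊤, hηU⟩⟩
  let ι : K →+* Γ(Spec (CommRingCat.of K), ⊤) := (Scheme.ΓSpecIso (CommRingCat.of K)).inv.hom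
  let φU : K →+* Γ(Y, U) := (f.appLE ⊤ U le_top).hom.comp ι
  letI algU : Algebra K Γ(Y, U) := φU.toAlgebra
  haveI : Algebra.FiniteType K Γ(Y, U) := by
    have h1 : (f.appLE ⊤ U le_top).hom.FiniteType :=
      f.finiteType_appLE (isAffineOpen_top _) hU le_top
    have h2 : ι.FiniteType :=
      RingHom.FiniteType.of_surjective _
        (Scheme.ΓSpecIso (CommRingCat.of K)).symm.commRingCatIsoToRingEquiv.surjective
    exact h1.comp h2
  haveI : IsFractionRing Γ(Y, U) Y.functionField :=
    functionField_isFractionRing_of_isAffineOpen Y U hU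
  haveI : IsScalarTower K Γ(Y, U) Y.functionField := by
    refine IsScalarTower.of_algebraMap_eq fun c ↦ ?_
    change (Y.presheaf.germ ⊤ (genericPoint Y) trivial) (f.appTop (ι c)) =
      Y.germToFunctionField U ((f.app ⊤ ≫ Y.presheaf.map (homOfLE le_top).op) (ι c))
    have hres := TopCat.Presheaf.germ_res Y.presheaf (homOfLE (le_top : U ≤ ⊤)) (genericPoint Y)
      hηU
    rw [Scheme.germToFunctionField, ← hres]
    rfl
  haveI : FaithfulSMul Γ(Y, U) Y.functionField :=
    (faithfulSMul_iff_algebraMap_injective _ _).mpr (IsFractionRing.injective _ _)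
  haveI : Algebra.IsAlgebraic Γ(Y, U) Y.functionField :=
    IsLocalization.isAlgebraic _ (nonZeroDivisors Γ(Y, U))
  have htr : Algebra.trdeg K Y.functionField = Algebra.trdeg K Γ(Y, U) := by
    rw [← trdeg_add_eq K Γ(Y, U) (A := Y.functionField), trdeg_eq_zero (R := Γ(Y, U)),
      add_zero]
  rw [height_top_eq_ringKrullDim f hU, htr]
  exact Literature.RingTheory.KrullDimension.ringKrullDim_eq_trdeg K Γ(Y, U)

/-! ### `K`-linearity of `p^♯ : R(Y) → R(X)` for `K`-morphisms -/

omit [LocallyOfFiniteType f] in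
/-- For a dominant morphism `p : X → Y` of integral schemes over `Spec K`, the map of function
fields `p^♯ : R(Y) → R(X)` (`RatFn.functionFieldMap`) is `K`-linear for the `K`-algebra structures
`K = Γ(Spec K) → Γ(-, ⊤) → R(-)`. [folklore] -/
theorem functionFieldMap_algebraMap_top {X : Scheme.{u}} [IsIntegral X] (p : X ⟶ Y) [IsDominant p]
    (fX : X ⟶ Spec (.of K)) (h : p ≫ f = fX) (c : K) :
    RatFn.functionFieldMap p ((Y.presheaf.germ ⊤ (genericPoint Y) trivial)
      (f.appTop ((Scheme.ΓSpecIso (.of K)).inv c))) =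
      (X.presheaf.germ ⊤ (genericPoint X) trivial)
        (fX.appTop ((Scheme.ΓSpecIso (.of K)).inv c)) := by
  haveI : Nonempty (⊤ : Y.Opens) := ⟨⟨⊤, trivial⟩⟩
  haveI : Nonempty (p ⁻¹ᵁ (⊤ : Y.Opens)) := ⟨⟨⊤, trivial⟩⟩
  subst h
  exact functionFieldMap_germToFunctionField p ⊤ (f.appTop ((Scheme.ΓSpecIso (.of K)).inv c))
    (⊤ : X) trivial

include f in
/-- The transcendence degree of the function field of an integral scheme locally of finite type
over a field is finite (it is that of any affine chart, an affine domain). [folklore] -/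
theorem trdeg_functionField_lt_aleph0 :
    letI := ((Y.presheaf.germ ⊤ (genericPoint Y) trivial).hom.comp
      (f.appTop.hom.comp (Scheme.ΓSpecIso (.of K)).inv.hom)).toAlgebra
    Algebra.trdeg K Y.functionField < Cardinal.aleph0 := by
  letI algK := ((Y.presheaf.germ ⊤ (genericPoint Y) trivial).hom.comp
      (f.appTop.hom.comp (Scheme.ΓSpecIso (.of K)).inv.hom)).toAlgebra
  obtain ⟨_, ⟨U, hU, rfl⟩, hηU, -⟩ :=
    Y.isBasis_affineOpens.exists_subset_of_mem_open (Set.mem_univ (⊤ : Y)) isOpen_univ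
  have hU : IsAffineOpen U := hU
  haveI : Nonempty U := ⟨⟨⊤, hηU⟩⟩
  let ι : K →+* Γ(Spec (CommRingCat.of K), ⊤) := (Scheme.ΓSpecIso (CommRingCat.of K)).inv.hom
  let φU : K →+* Γ(Y, U) := (f.appLE ⊤ U le_top).hom.comp ι
  letI algU : Algebra K Γ(Y, U) := φU.toAlgebra
  haveI : Algebra.FiniteType K Γ(Y, U) := by
    have h1 : (f.appLE ⊤ U le_top).hom.FiniteType :=
      f.finiteType_appLE (isAffineOpen_top _) hU le_top
    have h2 : ι.FiniteType :=
      RingHom.FiniteType.of_surjective _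
        (Scheme.ΓSpecIso (CommRingCat.of K)).symm.commRingCatIsoToRingEquiv.surjective
    exact h1.comp h2
  haveI : IsFractionRing Γ(Y, U) Y.functionField :=
    functionField_isFractionRing_of_isAffineOpen Y U hU
  haveI : IsScalarTower K Γ(Y, U) Y.functionField := by
    refine IsScalarTower.of_algebraMap_eq fun c ↦ ?_
    change (Y.presheaf.germ ⊤ (genericPoint Y) trivial) (f.appTop (ι c)) =
      Y.germToFunctionField U ((f.app ⊤ ≫ Y.presheaf.map (homOfLE le_top).op) (ι c))
    have hres := TopCat.Presheaf.germ_res Y.presheaf (homOfLE (le_top : U ≤ ⊤)) (genericPoint Y)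
      hηU
    rw [Scheme.germToFunctionField, ← hres]
    rfl
  haveI : FaithfulSMul Γ(Y, U) Y.functionField :=
    (faithfulSMul_iff_algebraMap_injective _ _).mpr (IsFractionRing.injective _ _)
  haveI : Algebra.IsAlgebraic Γ(Y, U) Y.functionField :=
    IsLocalization.isAlgebraic _ (nonZeroDivisors Γ(Y, U))
  have htr : Algebra.trdeg K Y.functionField = Algebra.trdeg K Γ(Y, U) := by
    rw [← trdeg_add_eq K Γ(Y, U) (A := Y.functionField), trdeg_eq_zero (R := Γ(Y, U)),
      add_zero]
  rw [htr, Literature.RingTheory.KrullDimension.trdeg_eq_toNat K Γ(Y, U)]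
  exact Cardinal.natCast_lt_aleph0

include f in
/-- **Birational invariance of dimension**: integral schemes locally of finite type over a field
with `K`-isomorphic function fields have the same dimension (`dim = trdeg_K R(-)`,
`height_top_eq_trdeg`). [cite: GortzWedhorn2020, Thm. 5.22 (3)] -/
theorem height_top_eq_of_algEquiv {X : Scheme.{u}} [IsIntegral X] (fX : X ⟶ Spec (.of K))
    [LocallyOfFiniteType fX]
    (e : letI := ((Y.presheaf.germ ⊤ (genericPoint Y) trivial).hom.comp
        (f.appTop.hom.comp (Scheme.ΓSpecIso (.of K)).inv.hom)).toAlgebra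
      letI := ((X.presheaf.germ ⊤ (genericPoint X) trivial).hom.comp
        (fX.appTop.hom.comp (Scheme.ΓSpecIso (.of K)).inv.hom)).toAlgebra
      Y.functionField ≃ₐ[K] X.functionField) :
    height (⊤ : X) = height (⊤ : Y) := by
  letI algY := ((Y.presheaf.germ ⊤ (genericPoint Y) trivial).hom.comp
      (f.appTop.hom.comp (Scheme.ΓSpecIso (.of K)).inv.hom)).toAlgebra
  letI algX := ((X.presheaf.germ ⊤ (genericPoint X) trivial).hom.comp
      (fX.appTop.hom.comp (Scheme.ΓSpecIso (.of K)).inv.hom)).toAlgebra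
  have hX := height_top_eq_trdeg fX
  have hY := height_top_eq_trdeg f
  rw [AlgEquiv.trdeg_eq e] at hY
  rw [← hX] at hY
  exact_mod_cast hY.symm

include f in
/-- **Relative dimension is the transcendence degree of the function field extension**: for a
dominant `K`-morphism `p : X → Y` of integral schemes locally of finite type over a field,
`dim X = dim Y + trdeg_{R(Y)} R(X)` (both dimensions being transcendence degrees over `K`,
`height_top_eq_trdeg`, and transcendence degree being additive in towers, Stacks 030H).
[cite: GortzWedhorn2020, Thm. 5.22 (3)] -/
theorem height_top_eq_height_top_add_trdeg {X : Scheme.{u}} [IsIntegral X] (p : X ⟶ Y)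
    [IsDominant p] (fX : X ⟶ Spec (.of K)) [LocallyOfFiniteType fX] (h : p ≫ f = fX) :
    letI := (RatFn.functionFieldMap p).toAlgebra
    Algebra.trdeg Y.functionField X.functionField < Cardinal.aleph0 ∧
    ((height (⊤ : X) : ℕ∞) : WithBot ℕ∞) = ((height (⊤ : Y) : ℕ∞) : WithBot ℕ∞) +
      (Cardinal.toNat (Algebra.trdeg Y.functionField X.functionField) : WithBot ℕ∞) := by
  letI algYX := (RatFn.functionFieldMap p).toAlgebra
  letI algY := ((Y.presheaf.germ ⊤ (genericPoint Y) trivial).hom.comp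
      (f.appTop.hom.comp (Scheme.ΓSpecIso (.of K)).inv.hom)).toAlgebra
  letI algX := ((X.presheaf.germ ⊤ (genericPoint X) trivial).hom.comp
      (fX.appTop.hom.comp (Scheme.ΓSpecIso (.of K)).inv.hom)).toAlgebra
  haveI : IsScalarTower K Y.functionField X.functionField :=
    IsScalarTower.of_algebraMap_eq fun c ↦ (functionFieldMap_algebraMap_top f p fX h c).symm
  have hadd := trdeg_add_eq K Y.functionField (A := X.functionField)
  have hXfin := trdeg_functionField_lt_aleph0 fX
  have hYfin := trdeg_functionField_lt_aleph0 f
  have hrel : Algebra.trdeg Y.functionField X.functionField < Cardinal.aleph0 :=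
    lt_of_le_of_lt (hadd ▸ self_le_add_left _ _) hXfin
  refine ⟨hrel, ?_⟩
  rw [height_top_eq_trdeg fX, height_top_eq_trdeg f, ← hadd, Cardinal.toNat_add hYfin hrel]
  push_cast
  rfl

end Dim

end Literature.AlgebraicGeometry.Motives

end
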